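import Mathlib.RingTheory.MvPolynomial.Basic
import Mathlib.RingTheory.Ideal.Quotient.Operations
import Mathlib.LinearAlgebra.Quotient.Basic
import Mathlib.LinearAlgebra.Basis.Basic
import Mathlib.RingTheory.Ideal.Operations
import Mathlib.Algebra.MvPolynomial.CommRing
import HarnessLib

/-!
# The Kummer root cover `O[s_1, …, s_r]/(s_j^p - x_j)` and its monomial basis

Topic: `Literature/AlgebraicGeometry/Resolution`. DEFINITION, with the basic structure theory
(all proved), of the finite free cover of a commutative ring `O` obtained by adjoining `p`-th
roots `s_j` of given elements `x_1, …, x_r`: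

  `RootCover p x = O[X_1, …, X_r]/(X_j^p - x_j)_j`.

When `O` is a regular local ring of characteristic `p` and the `x_j` are regular parameters
(local equations of an snc boundary), this is again a regular local ring (the `s_j` replacing
the `x_j` as parameters), and the normalised Kummer cover `τ^p = x^c` of the boundary is its
degree-`𝔽_p c` part for the `(ℤ/p)ʳ`-grading by exponents — the toric local model of
K. Kato, *Toric singularities*, Amer. J. Math. 116 (1994), (2.2)(2) (log regularity of the
normalised `p`-cyclic cover along an snc divisor), used by the endgame of the crux
`PicoverLocalModel`. This file only builds the cover and its `O`-basis of monomials
`s^n = ∏ s_j^{n_j}`, `0 ≤ n_j < p`: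

* `RootCover p x`, `RootCover.root j` (`s_j`), `root_pow` (`s_j^p = x_j`),
  `RootCover.boxMonomial n` (`s^n` for `n : Fin r → Fin p`);
* `RootCover.coord` — the coordinate functional (reduction of exponents modulo `p`:
  `X^m ↦ x^{m div p} · e_{m mod p}`), `coord_boxMonomial`;
* `RootCover.span_boxMonomial_eq_top`, `RootCover.basis` — the monomials `s^n`,
  `n : Fin r → Fin p`, form an `O`-basis (`basis_apply`).

What is NOT here: locality/regularity of the cover, the grading and the toric subalgebra.

Sources: [Kato1994] K. Kato, *Toric singularities*, Amer. J. Math. 116 (1994), (2.2)(2),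
Thm. (4.1). [Giraud1983] J. Giraud, Bull. SMF 111 (1983), Prop. 1.5.
-/

noncomputable section

namespace Literature.AlgebraicGeometry.Resolution

open MvPolynomial

variable {O : Type*} [CommRing O] {r : ℕ}

/-- The defining ideal `(X_j^p - x_j)_j` of the root cover. [cite: Kato1994, (2.2)(2)] -/
def rootCoverIdeal (p : ℕ) (x : Fin r → O) : Ideal (MvPolynomial (Fin r) O) :=
  Ideal.span (Set.range fun j : Fin r => (X j : MvPolynomial (Fin r) O) ^ p - C (x j))

/-- **The Kummer root cover** `O[s_1, …, s_r]/(s_j^p - x_j)`: the `O`-algebra obtained by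
adjoining `p`-th roots of `x_1, …, x_r`. [cite: Kato1994, (2.2)(2)] -/
def RootCover (p : ℕ) (x : Fin r → O) : Type _ :=
  MvPolynomial (Fin r) O ⧸ rootCoverIdeal p x

namespace RootCover

variable {p : ℕ} {x : Fin r → O}

/-- The root cover is a commutative ring (a quotient of a polynomial ring). [folklore] -/
instance : CommRing (RootCover p x) := inferInstanceAs (CommRing (MvPolynomial (Fin r) O ⧸ _))

/-- The root cover is an `O`-algebra. [folklore] -/
instance : Algebra O (RootCover p x) :=
  inferInstanceAs (Algebra O (MvPolynomial (Fin r) O ⧸ rootCoverIdeal p x))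

/-- The root cover is inhabited (by `0`). [folklore] -/
instance : Inhabited (RootCover p x) := ⟨0⟩

variable (p x) in
/-- The quotient map from the polynomial ring. [folklore] -/
def mk : MvPolynomial (Fin r) O →ₐ[O] RootCover p x :=
  Ideal.Quotient.mkₐ O (rootCoverIdeal p x)

/-- The quotient map is surjective. [folklore] -/
theorem mk_surjective : Function.Surjective (mk p x) :=
  Ideal.Quotient.mk_surjective

variable (p x) in
/-- The adjoined root `s_j`. [cite: Kato1994, (2.2)(2)] -/
def root (j : Fin r) : RootCover p x := mk p x (X j)

/-- The defining relation `s_j^p = x_j`. [cite: Kato1994, (2.2)(2)] -/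
theorem root_pow (j : Fin r) : root p x j ^ p = algebraMap O (RootCover p x) (x j) := by
  rw [root, ← map_pow, ← sub_eq_zero, Algebra.algebraMap_eq_smul_one, ← map_one (mk p x),
    ← map_smul, ← map_sub, smul_eq_C_mul, mul_one]
  exact Ideal.Quotient.eq_zero_iff_mem.mpr (Ideal.subset_span ⟨j, rfl⟩)

/-- Powers of a root reduce modulo `p`: `s_j^m = x_j^{m / p} · s_j^{m % p}`. [folklore] -/
theorem root_pow_eq (j : Fin r) (m : ℕ) :
    root p x j ^ m = algebraMap O _ (x j ^ (m / p)) * root p x j ^ (m % p) := by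
  conv_lhs => rw [← Nat.div_add_mod m p, pow_add, pow_mul, root_pow, ← map_pow]

variable (p x) in
/-- The monomial `s^n = ∏ s_j^{n_j}` of the box `0 ≤ n_j < p`. [cite: Kato1994, (2.2)(2)] -/
def boxMonomial (n : Fin r → Fin p) : RootCover p x := ∏ j, root p x j ^ (n j : ℕ)

/-- The image of a monomial of the polynomial ring. [folklore] -/
theorem mk_monomial (m : Fin r →₀ ℕ) (a : O) :
    mk p x (monomial m a) = a • ∏ j, root p x j ^ m j := by
  rw [monomial_eq, map_mul, Finsupp.prod_fintype _ _ (fun i => by rw [pow_zero]), map_prod]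
  simp only [map_pow, Algebra.smul_def]
  rfl

section Basis

variable [hp : Fact p.Prime]

/-- Reduction of an exponent vector modulo `p`, into the box. [folklore] -/
def modBox (m : Fin r →₀ ℕ) : Fin r → Fin p := fun j => ⟨m j % p, Nat.mod_lt _ hp.out.pos⟩

/-- The image of a monomial is `x^{m / p}` times the box monomial of `m mod p`. [folklore] -/
theorem mk_monomial_eq_smul_boxMonomial (m : Fin r →₀ ℕ) (a : O) :
    mk p x (monomial m a) = (a * ∏ j, x j ^ (m j / p)) • boxMonomial p x (modBox m) := by
  rw [mk_monomial, boxMonomial, mul_smul, Algebra.smul_def (∏ j, x j ^ (m j / p)), map_prod,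
    ← Finset.prod_mul_distrib]
  congr 1
  refine Finset.prod_congr rfl fun j _ => ?_
  rw [root_pow_eq j (m j)]
  rfl

/-- **The box monomials span the root cover** as an `O`-module. [cite: Kato1994, (2.2)(2)] -/
theorem span_boxMonomial_eq_top :
    Submodule.span O (Set.range (boxMonomial p x)) = ⊤ := by
  refine top_le_iff.mp fun b _ => ?_
  obtain ⟨F, rfl⟩ := mk_surjective b
  rw [F.as_sum, map_sum]
  refine Submodule.sum_mem _ fun m _ => ?_
  rw [mk_monomial_eq_smul_boxMonomial]
  exact Submodule.smul_mem _ _ (Submodule.subset_span ⟨_, rfl⟩)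

/-- The reduction functional on the polynomial ring: `a X^m ↦ (a x^{m / p}) · e_{m mod p}`.
[folklore] -/
def reduce : MvPolynomial (Fin r) O →ₗ[O] ((Fin r → Fin p) → O) :=
  (basisMonomials (Fin r) O).constr O fun m => (∏ j, x j ^ (m j / p)) • Pi.single (modBox m) 1

/-- Value of the reduction functional on a monomial. [folklore] -/
theorem reduce_monomial (m : Fin r →₀ ℕ) (a : O) :
    reduce (x := x) (monomial m a) = (a * ∏ j, x j ^ (m j / p)) • Pi.single (modBox (p := p) m) 1 := by
  have : monomial m a = a • basisMonomials (Fin r) O m := by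
    rw [coe_basisMonomials, smul_monomial, smul_eq_mul, mul_one]
  rw [this, map_smul, reduce, Module.Basis.constr_basis, ← mul_smul]

/-- The reduction functional kills the defining relations: `reduce ((X_j^p - x_j) X^m a) = 0`.
[folklore] -/
theorem reduce_rel_mul_monomial (j : Fin r) (m : Fin r →₀ ℕ) (a : O) :
    reduce (x := x) (p := p) (((X j : MvPolynomial (Fin r) O) ^ p - C (x j)) * monomial m a) = 0 := by
  have hp0 : 0 < p := hp.out.pos
  rw [sub_mul, X_pow_eq_monomial, monomial_mul, one_mul, C_mul_monomial, map_sub,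
    reduce_monomial, reduce_monomial, sub_eq_zero]
  have hmod : modBox (p := p) (Finsupp.single j p + m) = modBox m := by
    ext i
    simp only [modBox, Finsupp.add_apply]
    by_cases hij : i = j
    · subst hij
      rw [Finsupp.single_eq_same, Nat.add_comm, Nat.add_mod_right]
    · rw [Finsupp.single_eq_of_ne hij, zero_add]
  have hdiv : ∏ i, x i ^ ((Finsupp.single j p + m) i / p) = x j * ∏ i, x i ^ (m i / p) := by
    rw [← Finset.mul_prod_erase Finset.univ _ (Finset.mem_univ j),
      ← Finset.mul_prod_erase Finset.univ (fun i => x i ^ (m i / p)) (Finset.mem_univ j),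
      ← mul_assoc]
    congr 1
    · simp only [Finsupp.add_apply, Finsupp.single_eq_same]
      rw [Nat.add_div_left _ hp0, pow_succ', ]
    · refine Finset.prod_congr rfl fun i hi => ?_
      rw [Finsupp.add_apply, Finsupp.single_eq_of_ne (Finset.ne_of_mem_erase hi), zero_add]
  rw [hmod, hdiv]
  congr 1
  ring

/-- The reduction functional vanishes on the defining ideal. [folklore] -/
theorem reduce_eq_zero_of_mem {F : MvPolynomial (Fin r) O} (hF : F ∈ rootCoverIdeal p x) :
    reduce (x := x) (p := p) F = 0 := by
  obtain ⟨c, rfl⟩ := Ideal.mem_span_range_iff_exists_fun.mp hF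
  rw [map_sum]
  refine Finset.sum_eq_zero fun j _ => ?_
  induction c j using MvPolynomial.induction_on' with
  | monomial m a => rw [mul_comm]; exact reduce_rel_mul_monomial j m a
  | add f g hf hg => rw [add_mul, map_add, hf, hg, add_zero]

/-- **The coordinate functional** of the root cover with respect to the box monomials,
descended from `reduce`. [folklore] -/
def coord : RootCover p x →ₗ[O] ((Fin r → Fin p) → O) :=
  (((rootCoverIdeal p x).restrictScalars O).liftQ reduce
      (fun _ hF => reduce_eq_zero_of_mem hF)).comp
    (Submodule.Quotient.restrictScalarsEquiv O (rootCoverIdeal p x)).symm.toLinearMap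

/-- `coord` computes `reduce` on representatives. [folklore] -/
theorem coord_mk (F : MvPolynomial (Fin r) O) : coord (mk p x F) = reduce (p := p) (x := x) F :=
  rfl

/-- The coordinates of a box monomial: the standard basis vector. [folklore] -/
theorem coord_boxMonomial (n : Fin r → Fin p) :
    coord (boxMonomial p x n) = Pi.single n 1 := by
  have h1 : boxMonomial p x n =
      mk p x (monomial (Finsupp.equivFunOnFinite.symm fun j => (n j : ℕ)) 1) := by
    rw [mk_monomial, one_smul, boxMonomial]
    rfl
  rw [h1, coord_mk, reduce_monomial, one_mul]
  have hdiv : ∏ j, x j ^ ((Finsupp.equivFunOnFinite.symm fun j => (n j : ℕ)) j / p) = 1 := by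
    refine Finset.prod_eq_one fun j _ => ?_
    rw [Finsupp.coe_equivFunOnFinite_symm, Nat.div_eq_of_lt (n j).2, pow_zero]
  have hmod : modBox (p := p) (Finsupp.equivFunOnFinite.symm fun j => (n j : ℕ)) = n := by
    ext j
    simp [modBox, Nat.mod_eq_of_lt (n j).2]
  rw [hdiv, hmod, one_smul]

/-- The box monomials are linearly independent over `O`. [folklore] -/
theorem linearIndependent_boxMonomial : LinearIndependent O (boxMonomial p x) := by
  refine LinearIndependent.of_comp coord ?_
  have : coord ∘ boxMonomial p x = fun n => Pi.single n (1 : O) := funext coord_boxMonomial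
  rw [this]
  convert (Pi.basisFun O (Fin r → Fin p)).linearIndependent
  simp

variable (p x) in
/-- **The monomial basis of the root cover**: `s^n`, `n : Fin r → Fin p`, is an `O`-basis of
`O[s]/(s^p - x)` (a free `O`-module of rank `pʳ`). [cite: Kato1994, (2.2)(2)] -/
def basis : Module.Basis (Fin r → Fin p) O (RootCover p x) :=
  Module.Basis.mk linearIndependent_boxMonomial (span_boxMonomial_eq_top (p := p) (x := x)).ge

/-- The basis vectors are the box monomials. [folklore] -/
@[simp] theorem basis_apply (n : Fin r → Fin p) : basis p x n = boxMonomial p x n :=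
  Module.Basis.mk_apply _ _ n

/-- The coordinate functional is the coordinate map of the basis. [folklore] -/
theorem coord_apply_eq_repr (b : RootCover p x) (n : Fin r → Fin p) :
    coord b n = (basis p x).repr b n := by
  have : coord = (Finsupp.linearEquivFunOnFinite O O (Fin r → Fin p)).toLinearMap ∘ₗ
      (basis p x).repr.toLinearMap := by
    refine (basis p x).ext fun m => ?_
    rw [LinearMap.comp_apply, LinearEquiv.coe_toLinearMap, LinearEquiv.coe_toLinearMap,
      Module.Basis.repr_self, basis_apply, coord_boxMonomial]
    ext k
    simp [Finsupp.linearEquivFunOnFinite_apply, Finsupp.single_apply, Pi.single_apply, eq_comm]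
  rw [this]
  rfl

/-- The root cover is a free `O`-module. [folklore] -/
instance free : Module.Free O (RootCover p x) := Module.Free.of_basis (basis p x)

/-- The root cover is a finite `O`-module. [folklore] -/
instance finite : Module.Finite O (RootCover p x) :=
  Module.Finite.of_basis (ι := Fin r → Fin p) (basis p x)

end Basis

end RootCover

end Literature.AlgebraicGeometry.Resolution

end
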